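import Literature.AnabelianGeometry.SemiGraphs.ArithQuasiGeometricOpenness
import HarnessLib

/-!
# [SemiAnbd] Def 5.3 (ii) — total arithmetic estrangement PULLS BACK along augmentation-compatible
# homomorphisms (transfer lemma)

Mochizuki, *Semi-graphs of anabelioids*, Publ. RIMS **42** (2006) 221–322, §5 Def 5.3 (i)/(ii) p. 65
(arithmetically ample: «surjects onto an open subgroup of `Π_A`»; arithmetically estranged edge; totally
arithmetically estranged). [cite: MochizukiSemiAnbd2006, Def 5.3 (ii), p. 65]

PROOF-ONLY file (cell abc-iut, layer L3, row «NV-T54-RESIDUAL stage 1», seat abc-iut-w6-d099 gen 6; generic,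
no carrier).  `IsArithAmple.of_map_le`: arithmetic ampleness PUSHES FORWARD along a homomorphism `φ : G₁ → G₂`
with `aug₂ ∘ φ = aug₁` into any subgroup containing the image (the image in `Π_A` only grows, and a subgroup
containing an open subgroup is open).  `IsTotallyArithEstranged.of_map`: consequently total arithmetic
estrangement of decomposition data `D₂` on `G₂` PULLS BACK to decomposition data `D₁` on `G₁` with the same
branches and abutments, provided `φ` maps vertex groups into vertex groups, branch groups into branch groups,
and the branch groups of `D₁` are the full preimages of those of `D₂` inside the vertex groups (needed for the
`g ∉ Π_b` clause).  Use (stage 2 of the row): `hest` proved at a compact quotient witness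
(`ArithTotalEstrangementTransportWitness.lean`) lifts to any tempered chart `π₁^temp(𝒢) ⋊^out Π_A` mapping to it
compatibly.  No definition, no new named fact; nothing here bears on [IUTchIII] Cor 3.12; typed ≠ proved elsewhere.
-/

namespace Literature.AnabelianGeometry.SemiGraphs

universe u u' w w'

/-! ### §0 Transfer: total arithmetic estrangement pulls back along `aug`-compatible homomorphisms -/

section Transfer

variable {G₁ : Type u} {G₂ : Type u} [Group G₁] [Group G₂] [TopologicalSpace G₁] [TopologicalSpace G₂]
variable {PA : Type u'} [Group PA] [TopologicalSpace PA] [ContinuousMul PA]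
variable {V : Type w} {B : Type w'}

omit [TopologicalSpace G₁] [TopologicalSpace G₂] in
/-- Arithmetic ampleness pushes forward along an `aug`-compatible homomorphism into any larger subgroup.
[cite: MochizukiSemiAnbd2006, Def 5.3 (i), p. 65] -/
theorem IsArithAmple.of_map_le {aug₁ : G₁ →* PA} {aug₂ : G₂ →* PA} (φ : G₁ →* G₂)
    (haug : ∀ g, aug₂ (φ g) = aug₁ g) {K₁ : Subgroup G₁} {K₂ : Subgroup G₂} (hle : K₁.map φ ≤ K₂)
    (h : IsArithAmple aug₁ K₁) : IsArithAmple aug₂ K₂ := by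
  have e : K₁.map aug₁ = (K₁.map φ).map aug₂ := by
    rw [Subgroup.map_map]; congr 1; ext g; simp [haug]
  unfold IsArithAmple at h ⊢
  rw [e] at h
  exact Subgroup.isOpen_mono (Subgroup.map_mono hle) h

omit [TopologicalSpace G₁] [TopologicalSpace G₂] in
/-- **TRANSFER of total arithmetic estrangement.**  Let `φ : G₁ → G₂` commute with the augmentations,
and let `D₁`, `D₂` be decomposition data on the same branches with the same abutments such that `φ` maps
vertex groups into vertex groups and branch groups into branch groups, the branch groups of `D₁` being
the full preimages of those of `D₂` inside the vertex groups.  If `D₂` is totally arithmetically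
estranged, so is `D₁` (non-ampleness pulls back).  This is the interface by which `hest` at a compact
quotient witness lifts to a tempered chart mapping to it. [cite: MochizukiSemiAnbd2006, Def 5.3 (ii), p. 65] -/
theorem IsTotallyArithEstranged.of_map {aug₁ : G₁ →* PA} {aug₂ : G₂ →* PA} (φ : G₁ →* G₂)
    (haug : ∀ g, aug₂ (φ g) = aug₁ g) (D₁ : DecompositionData G₁ V B) (D₂ : DecompositionData G₂ V B)
    (habut : ∀ b, D₁.abut b = D₂.abut b)
    (hV : ∀ v, (D₁.vertGp v).map φ ≤ D₂.vertGp v) (hB : ∀ b, (D₁.brGp b).map φ ≤ D₂.brGp b)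
    (hfull : ∀ b v, D₁.abut b = some v → ∀ g ∈ D₁.vertGp v, φ g ∈ D₂.brGp b → g ∈ D₁.brGp b)
    (h₂ : IsTotallyArithEstranged D₂ aug₂) : IsTotallyArithEstranged D₁ aug₁ := by
  intro e b _ v hv g hg
  have hv₂ : D₂.abut b = some v := (habut b) ▸ hv
  obtain ⟨hA, hB'⟩ := h₂ (D₂.edgeOf b) b rfl v hv₂ (φ g) (hV v ⟨g, hg, rfl⟩)
  have mono : ∀ b₁ b₂ : B, (D₁.brGp b₁ ⊓ conjSubgroup g (D₁.brGp b₂)).map φ ≤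
      D₂.brGp b₁ ⊓ conjSubgroup (φ g) (D₂.brGp b₂) := fun b₁ b₂ =>
    (Subgroup.map_inf_le _ _ _).trans (inf_le_inf (hB b₁)
      (by rw [ArithOpenness.map_conjSubgroup]; exact Subgroup.map_mono (f := (MulAut.conj (φ g)).toMonoidHom) (hB b₂)))
  refine ⟨fun b' hb' hne hamp => ?_, fun hgb hamp => ?_⟩
  · exact hA b' ((habut b') ▸ hb') hne (hamp.of_map_le φ haug (mono b b'))
  · exact hB' (fun h => hgb (hfull b v hv g hg h)) (hamp.of_map_le φ haug (mono b b))

end Transfer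

end Literature.AnabelianGeometry.SemiGraphs
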